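import Literature.Geometry.Lorentzian.CoordMetricPair
import HarnessLib

/-!
# Two metrics on one chart, II: the divergence form of the `DA`-terms (Kotschwar 2014, `div U`)

Continuation of `CoordMetricPair.lean`. There the difference of the right-hand sides of the
evolution of the Ricci tensor for two metrics `G, G'` on one chart was split as
`Λ(G) − Λ(G') = Σ g^{ij} D²P(bᵢ,bⱼ;Y,Z) + divRaw + fRaw`, where `divRaw` collects the terms that are
linear in `DA = DΓ − DΓ'`, the derivative of the connection difference `A = Γ − Γ'` (`chrDiff`),
and are therefore NOT controlled pointwise by `H, A, P, dP`. Following Kotschwar 2014, §1.1,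
(8): "`∂_t S = ΔS + div U + …` where `U = g^{ab}∇_b R̃ − g̃^{ab}∇̃_b R̃ … |U| ≤ C(|h| + |A|)`", we
write these terms as a **divergence of potentials which are linear in `A`** plus a correction
linear in `A`:

* `uPot G G' b Y Z i`, `vPot G G' b Z` — the potentials (explicit smooth real functions on the
  chart, sums of products `g'^{ij} · Ric'(A(·)·, ·)`);
* `fderiv_uPot`, `fderiv_vPot` — their derivatives (product rule);
* **`divRaw_eq`** — `divRaw = Σᵢ ∂_{bᵢ} uPotᵢ + ∂_Y (vPot Z) + ∂_Z (vPot Y) − divCorr`;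
* the bounds `abs_uPot_le`, `abs_vPot_le` (`≤ c N^k ‖A‖`) and `abs_divCorr_le`
  (`≤ c n² N⁸ ‖A‖ ‖Y‖‖Z‖`) under a `PairBound`, and the smoothness of the potentials.

In the energy argument (`∫ ρ² P · div U = −∫ ∂(ρ² P) · U`) only the potentials and these bounds
are used. Everything is proved; no definition of `Prop` type is introduced.

## References

* B. Kotschwar, *An energy approach to the problem of uniqueness for the Ricci flow*,
  Comm. Anal. Geom. 22 (2014) 149–176 (arXiv:1206.3225), §1.1, (8), (10) (`div U`, `|U|`).
  [Kotschwar2014]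
-/

noncomputable section

set_option maxSynthPendingDepth 3

open Set Filter ContinuousLinearMap Module
open scoped Topology ContDiff

namespace Literature.Geometry.Lorentzian

namespace MetricCoord

variable {E : Type*} [NormedAddCommGroup E] [NormedSpace ℝ E]
  {ι : Type*} [Fintype ι] [FiniteDimensional ℝ E] [CompleteSpace E] (b : Basis ι ℝ E)

/-! ### The potentials -/

section Potentials

variable (G G' : E → E →L[ℝ] E →L[ℝ] ℝ)

/-- The bracket of the `i`-directional potential:
`−Ric'(A(bⱼ,Y),Z) − Ric'(Y,A(bⱼ,Z)) + Ric'(A(Y,Z),bⱼ) + Ric'(A(Z,Y),bⱼ) + Ric'(Z,A(Y,bⱼ)) + Ric'(Y,A(Z,bⱼ))`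
as a function of the point. [cite: Kotschwar2014, §1.1 (8)] -/
def uBracket (Y Z : E) (j : ι) (y : E) : ℝ :=
  -(ricAt G' y (chrDiff G G' y (b j) Y) Z) - ricAt G' y Y (chrDiff G G' y (b j) Z)
  + ricAt G' y (chrDiff G G' y Y Z) (b j) + ricAt G' y (chrDiff G G' y Z Y) (b j)
  + ricAt G' y Z (chrDiff G G' y Y (b j)) + ricAt G' y Y (chrDiff G G' y Z (b j))

/-- **The `bᵢ`-directional potential** `Uⁱ(y) = Σⱼ g'^{ij}(y) · uBracketⱼ(y)` (linear in `A`).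
[cite: Kotschwar2014, §1.1 (8)] -/
def uPot (Y Z : E) (i : ι) (y : E) : ℝ :=
  ∑ j, ginv G' b y i j * uBracket b G G' Y Z j y

/-- The bracket of the `Y`/`Z`-directional potential:
`−Ric'(A(bᵢ,Z),bⱼ) − Ric'(Z,A(bᵢ,bⱼ))`. [cite: Kotschwar2014, §1.1 (8)] -/
def vBracket (Z : E) (i j : ι) (y : E) : ℝ :=
  -(ricAt G' y (chrDiff G G' y (b i) Z) (b j)) - ricAt G' y Z (chrDiff G G' y (b i) (b j))

/-- **The `Y`-directional potential** `V_Z(y) = Σᵢⱼ g'^{ij}(y) · vBracket_Z(i,j)(y)` (the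
`Z`-directional one is `V_Y`). [cite: Kotschwar2014, §1.1 (8)] -/
def vPot (Z : E) (y : E) : ℝ :=
  ∑ i, ∑ j, ginv G' b y i j * vBracket b G G' Z i j y

/-- The derivative of `g'^{ij}` along `W`: `bⁱ(D♯'(W) bʲ)`. [folklore] -/
def dginv (x W : E) (i j : ι) : ℝ :=
  coordCLM b i (fderiv ℝ (sharpAt G') x W (coordCLM b j))

/-- The `DA`-part of `∂_W uBracketⱼ`. [cite: Kotschwar2014, §1.1 (8)] -/
def duDA (Y Z : E) (j : ι) (x W : E) : ℝ :=
  -(ricAt G' x (fderiv ℝ (chrDiff G G') x W (b j) Y) Z)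
  - ricAt G' x Y (fderiv ℝ (chrDiff G G') x W (b j) Z)
  + ricAt G' x (fderiv ℝ (chrDiff G G') x W Y Z) (b j)
  + ricAt G' x (fderiv ℝ (chrDiff G G') x W Z Y) (b j)
  + ricAt G' x Z (fderiv ℝ (chrDiff G G') x W Y (b j))
  + ricAt G' x Y (fderiv ℝ (chrDiff G G') x W Z (b j))

/-- The `A`-part of `∂_W uBracketⱼ` (derivative falling on `Ric'`). [cite: Kotschwar2014, §1.1 (8)] -/
def duA (Y Z : E) (j : ι) (x W : E) : ℝ :=
  -(fderiv ℝ (ricAt G') x W (chrDiff G G' x (b j) Y) Z)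
  - fderiv ℝ (ricAt G') x W Y (chrDiff G G' x (b j) Z)
  + fderiv ℝ (ricAt G') x W (chrDiff G G' x Y Z) (b j)
  + fderiv ℝ (ricAt G') x W (chrDiff G G' x Z Y) (b j)
  + fderiv ℝ (ricAt G') x W Z (chrDiff G G' x Y (b j))
  + fderiv ℝ (ricAt G') x W Y (chrDiff G G' x Z (b j))

/-- The `DA`-part of `∂_W vBracket`. [cite: Kotschwar2014, §1.1 (8)] -/
def dvDA (Z : E) (i j : ι) (x W : E) : ℝ :=
  -(ricAt G' x (fderiv ℝ (chrDiff G G') x W (b i) Z) (b j))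
  - ricAt G' x Z (fderiv ℝ (chrDiff G G') x W (b i) (b j))

/-- The `A`-part of `∂_W vBracket`. [cite: Kotschwar2014, §1.1 (8)] -/
def dvA (Z : E) (i j : ι) (x W : E) : ℝ :=
  -(fderiv ℝ (ricAt G') x W (chrDiff G G' x (b i) Z) (b j))
  - fderiv ℝ (ricAt G') x W Z (chrDiff G G' x (b i) (b j))

/-- **The correction `divCorr`**: the terms of `Σᵢ ∂ᵢUⁱ + ∂_Y V_Z + ∂_Z V_Y` in which the derivative
falls on the coefficients `g'^{ij}`, `Ric'` rather than on `A` (all linear in `A`).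
[cite: Kotschwar2014, §1.1 (8)] -/
def divCorr (x Y Z : E) : ℝ :=
  ∑ i, ∑ j, (dginv b G' x (b i) i j * uBracket b G G' Y Z j x + ginv G' b x i j * duA b G G' Y Z j x (b i)
    + dginv b G' x Y i j * vBracket b G G' Z i j x + ginv G' b x i j * dvA b G G' Z i j x Y
    + dginv b G' x Z i j * vBracket b G G' Y i j x + ginv G' b x i j * dvA b G G' Y i j x Z)

end Potentials

/-! ### Derivatives of the potentials -/

section Derivatives

variable {b} {G G' : E → E →L[ℝ] E →L[ℝ] ℝ} {V : Set E} {x : E}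

omit [Fintype ι] in
/-- `∂_W g'^{ij} = dginv`. [folklore] -/
theorem IsMetricOn.hasFDerivAt_ginv (hG' : IsMetricOn G' V) (hx : x ∈ V) (i j : ι) :
    HasFDerivAt (fun y ↦ ginv G' b y i j)
      ((coordCLM b i).comp ((fderiv ℝ (sharpAt G') x).flip (coordCLM b j))) x := by
  have h := hasFDerivAt_clm_apply_const (hG'.differentiableAt_sharpAt hx).hasFDerivAt (coordCLM b j)
  exact ((coordCLM b i).hasFDerivAt.comp x h :)

/-- The product terms `y ↦ Ric'_y(A_y(u,v), w)` are differentiable with the product-rule derivative.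
[folklore] -/
theorem IsMetricOn.hasFDerivAt_ric_chrDiff_left (hG : IsMetricOn G V) (hG' : IsMetricOn G' V)
    (hx : x ∈ V) (u v w : E) :
    HasFDerivAt (fun y ↦ ricAt G' y (chrDiff G G' y u v) w)
      (((ricAt G' x).comp (((fderiv ℝ (chrDiff G G') x).flip u).flip v)
        + (fderiv ℝ (ricAt G') x).flip (chrDiff G G' x u v)).flip w) x := by
  have hA : DifferentiableAt ℝ (chrDiff G G') x :=
    (((hG.contDiffOn_chrDiff hG') x hx).contDiffAt (hG.mem_nhds hx)).differentiableAt (by simp)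
  have hc : HasFDerivAt (fun y ↦ chrDiff G G' y u v) (((fderiv ℝ (chrDiff G G') x).flip u).flip v) x :=
    hasFDerivAt_clm_apply_const (hasFDerivAt_clm_apply_const hA.hasFDerivAt u) v
  exact hasFDerivAt_clm_apply_const ((hG'.differentiableAt_ricAt hx).hasFDerivAt.clm_apply hc) w

/-- The product terms `y ↦ Ric'_y(w, A_y(u,v))` are differentiable with the product-rule derivative.
[folklore] -/
theorem IsMetricOn.hasFDerivAt_ric_chrDiff_right (hG : IsMetricOn G V) (hG' : IsMetricOn G' V)
    (hx : x ∈ V) (u v w : E) :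
    HasFDerivAt (fun y ↦ ricAt G' y w (chrDiff G G' y u v))
      ((ricAt G' x w).comp (((fderiv ℝ (chrDiff G G') x).flip u).flip v)
        + ((fderiv ℝ (ricAt G') x).flip w).flip (chrDiff G G' x u v)) x := by
  have hA : DifferentiableAt ℝ (chrDiff G G') x :=
    (((hG.contDiffOn_chrDiff hG') x hx).contDiffAt (hG.mem_nhds hx)).differentiableAt (by simp)
  have hc : HasFDerivAt (fun y ↦ chrDiff G G' y u v) (((fderiv ℝ (chrDiff G G') x).flip u).flip v) x :=
    hasFDerivAt_clm_apply_const (hasFDerivAt_clm_apply_const hA.hasFDerivAt u) v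
  exact (hasFDerivAt_clm_apply_const (hG'.differentiableAt_ricAt hx).hasFDerivAt w).clm_apply hc

omit [Fintype ι] in
/-- **`∂_W uBracketⱼ = duA + duDA`**. [cite: Kotschwar2014, §1.1 (8)] -/
theorem IsMetricOn.fderiv_uBracket (hG : IsMetricOn G V) (hG' : IsMetricOn G' V) (hx : x ∈ V)
    (Y Z : E) (j : ι) (W : E) :
    fderiv ℝ (uBracket b G G' Y Z j) x W = duA b G G' Y Z j x W + duDA b G G' Y Z j x W := by
  have hl := hG.hasFDerivAt_ric_chrDiff_left hG' hx
  have hr := hG.hasFDerivAt_ric_chrDiff_right hG' hx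
  have h := (((((hl (b j) Y Z).fun_neg.fun_sub (hr (b j) Z Y)).fun_add (hl Y Z (b j))).fun_add
    (hl Z Y (b j))).fun_add (hr Y (b j) Z)).fun_add (hr Z (b j) Y)
  rw [show uBracket b G G' Y Z j = fun y ↦ -(ricAt G' y (chrDiff G G' y (b j) Y) Z)
      - ricAt G' y Y (chrDiff G G' y (b j) Z) + ricAt G' y (chrDiff G G' y Y Z) (b j)
      + ricAt G' y (chrDiff G G' y Z Y) (b j) + ricAt G' y Z (chrDiff G G' y Y (b j))
      + ricAt G' y Y (chrDiff G G' y Z (b j)) from rfl, h.fderiv]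
  simp only [duA, duDA, _root_.add_apply, _root_.sub_apply, _root_.neg_apply,
    ContinuousLinearMap.flip_apply, ContinuousLinearMap.comp_apply]
  ring

omit [Fintype ι] in
/-- The brackets are differentiable at the points of `V`. [folklore] -/
theorem IsMetricOn.differentiableAt_uBracket (hG : IsMetricOn G V) (hG' : IsMetricOn G' V) (hx : x ∈ V)
    (Y Z : E) (j : ι) : DifferentiableAt ℝ (uBracket b G G' Y Z j) x := by
  have hl := hG.hasFDerivAt_ric_chrDiff_left hG' hx
  have hr := hG.hasFDerivAt_ric_chrDiff_right hG' hx
  exact ((((((hl (b j) Y Z).fun_neg.fun_sub (hr (b j) Z Y)).fun_add (hl Y Z (b j))).fun_add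
    (hl Z Y (b j))).fun_add (hr Y (b j) Z)).fun_add (hr Z (b j) Y)).differentiableAt

omit [Fintype ι] in
/-- **`∂_W vBracket = dvA + dvDA`**. [cite: Kotschwar2014, §1.1 (8)] -/
theorem IsMetricOn.fderiv_vBracket (hG : IsMetricOn G V) (hG' : IsMetricOn G' V) (hx : x ∈ V)
    (Z : E) (i j : ι) (W : E) :
    fderiv ℝ (vBracket b G G' Z i j) x W = dvA b G G' Z i j x W + dvDA b G G' Z i j x W := by
  have hl := hG.hasFDerivAt_ric_chrDiff_left hG' hx
  have hr := hG.hasFDerivAt_ric_chrDiff_right hG' hx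
  have h := (hl (b i) Z (b j)).fun_neg.fun_sub (hr (b i) (b j) Z)
  rw [show vBracket b G G' Z i j = fun y ↦ -(ricAt G' y (chrDiff G G' y (b i) Z) (b j))
      - ricAt G' y Z (chrDiff G G' y (b i) (b j)) from rfl, h.fderiv]
  simp only [dvA, dvDA, _root_.add_apply, _root_.sub_apply, _root_.neg_apply,
    ContinuousLinearMap.flip_apply, ContinuousLinearMap.comp_apply]
  ring

omit [Fintype ι] in
/-- The brackets are differentiable at the points of `V`. [folklore] -/
theorem IsMetricOn.differentiableAt_vBracket (hG : IsMetricOn G V) (hG' : IsMetricOn G' V) (hx : x ∈ V)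
    (Z : E) (i j : ι) : DifferentiableAt ℝ (vBracket b G G' Z i j) x := by
  have hl := hG.hasFDerivAt_ric_chrDiff_left hG' hx
  have hr := hG.hasFDerivAt_ric_chrDiff_right hG' hx
  exact ((hl (b i) Z (b j)).fun_neg.fun_sub (hr (b i) (b j) Z)).differentiableAt

/-- **`∂_W Uⁱ = Σⱼ (∂_W g'^{ij}) uBracketⱼ + g'^{ij} (duA + duDA)`** (product rule).
[cite: Kotschwar2014, §1.1 (8)] -/
theorem IsMetricOn.fderiv_uPot (hG : IsMetricOn G V) (hG' : IsMetricOn G' V) (hx : x ∈ V)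
    (Y Z : E) (i : ι) (W : E) :
    fderiv ℝ (uPot b G G' Y Z i) x W =
      ∑ j, (dginv b G' x W i j * uBracket b G G' Y Z j x
        + ginv G' b x i j * (duA b G G' Y Z j x W + duDA b G G' Y Z j x W)) := by
  have hg := fun j ↦ hG'.hasFDerivAt_ginv (b := b) hx i j
  have hu := fun j ↦ (hG.differentiableAt_uBracket (b := b) hG' hx Y Z j).hasFDerivAt
  have hsum : HasFDerivAt (uPot b G G' Y Z i)
      (∑ j, (ginv G' b x i j • fderiv ℝ (uBracket b G G' Y Z j) x
        + uBracket b G G' Y Z j x • (coordCLM b i).comp ((fderiv ℝ (sharpAt G') x).flip (coordCLM b j)))) x := by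
    have h := HasFDerivAt.fun_sum (u := Finset.univ) fun j (_ : j ∈ Finset.univ) ↦ (hg j).mul (hu j)
    exact h
  rw [hsum.fderiv, FunLike.coe_sum, Finset.sum_apply]
  refine Finset.sum_congr rfl fun j _ ↦ ?_
  simp only [_root_.add_apply, _root_.smul_apply, ContinuousLinearMap.comp_apply,
    ContinuousLinearMap.flip_apply, smul_eq_mul, hG.fderiv_uBracket hG' hx, dginv]
  ring

/-- **`∂_W V_Z = Σᵢⱼ (∂_W g'^{ij}) vBracket + g'^{ij} (dvA + dvDA)`** (product rule).
[cite: Kotschwar2014, §1.1 (8)] -/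
theorem IsMetricOn.fderiv_vPot (hG : IsMetricOn G V) (hG' : IsMetricOn G' V) (hx : x ∈ V)
    (Z W : E) :
    fderiv ℝ (vPot b G G' Z) x W =
      ∑ i, ∑ j, (dginv b G' x W i j * vBracket b G G' Z i j x
        + ginv G' b x i j * (dvA b G G' Z i j x W + dvDA b G G' Z i j x W)) := by
  have hg := fun i j ↦ hG'.hasFDerivAt_ginv (b := b) hx i j
  have hv := fun i j ↦ (hG.differentiableAt_vBracket (b := b) hG' hx Z i j).hasFDerivAt
  have hsum : HasFDerivAt (vPot b G G' Z)
      (∑ i, ∑ j, (ginv G' b x i j • fderiv ℝ (vBracket b G G' Z i j) x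
        + vBracket b G G' Z i j x • (coordCLM b i).comp ((fderiv ℝ (sharpAt G') x).flip (coordCLM b j)))) x := by
    have h := HasFDerivAt.fun_sum (u := Finset.univ) fun i (_ : i ∈ Finset.univ) ↦
      HasFDerivAt.fun_sum (u := Finset.univ) fun j (_ : j ∈ Finset.univ) ↦ (hg i j).mul (hv i j)
    exact h
  rw [hsum.fderiv, FunLike.coe_sum, Finset.sum_apply]
  refine Finset.sum_congr rfl fun i _ ↦ ?_
  rw [FunLike.coe_sum, Finset.sum_apply]
  refine Finset.sum_congr rfl fun j _ ↦ ?_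
  simp only [_root_.add_apply, _root_.smul_apply, ContinuousLinearMap.comp_apply,
    ContinuousLinearMap.flip_apply, smul_eq_mul, hG.fderiv_vBracket hG' hx, dginv]
  ring

/-- **The divergence form of the `DA`-terms** (Kotschwar 2014, §1.1, (8): the term `div U`):
`Σᵢ ∂_{bᵢ} Uⁱ + ∂_Y V_Z + ∂_Z V_Y = divRaw + divCorr`. [cite: Kotschwar2014, §1.1 (8)] -/
theorem IsMetricOn.sum_fderiv_uPot_add (hG : IsMetricOn G V) (hG' : IsMetricOn G' V) (hx : x ∈ V)
    (Y Z : E) :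
    (∑ i, fderiv ℝ (uPot b G G' Y Z i) x (b i)) + fderiv ℝ (vPot b G G' Z) x Y
      + fderiv ℝ (vPot b G G' Y) x Z = divRaw b G G' x Y Z + divCorr b G G' x Y Z := by
  simp only [hG.fderiv_uPot hG' hx, hG.fderiv_vPot hG' hx, divRaw, divCorr, ← Finset.sum_add_distrib]
  refine Finset.sum_congr rfl fun i _ ↦ Finset.sum_congr rfl fun j _ ↦ ?_
  simp only [duDA, dvDA, reactDA, hG.fderiv_chrDiff hG' hx, _root_.sub_apply, map_sub]
  ring

/-- Equivalently: **`divRaw = Σᵢ ∂_{bᵢ} Uⁱ + ∂_Y V_Z + ∂_Z V_Y − divCorr`**. [cite: Kotschwar2014, §1.1 (8)] -/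
theorem IsMetricOn.divRaw_eq (hG : IsMetricOn G V) (hG' : IsMetricOn G' V) (hx : x ∈ V) (Y Z : E) :
    divRaw b G G' x Y Z = (∑ i, fderiv ℝ (uPot b G G' Y Z i) x (b i)) + fderiv ℝ (vPot b G G' Z) x Y
      + fderiv ℝ (vPot b G G' Y) x Z - divCorr b G G' x Y Z := by
  rw [hG.sum_fderiv_uPot_add hG' hx]; ring

end Derivatives

/-! ### Smoothness of the potentials -/

section Smoothness

variable {b} {G G' : E → E →L[ℝ] E →L[ℝ] ℝ} {V : Set E}

omit [Fintype ι] in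
/-- `y ↦ Ric'_y(A_y(u,v), w)` is `C^∞` on `V`. [folklore] -/
theorem IsMetricOn.contDiffOn_ric_chrDiff_left (hG : IsMetricOn G V) (hG' : IsMetricOn G' V) (u v w : E) :
    ContDiffOn ℝ ∞ (fun y ↦ ricAt G' y (chrDiff G G' y u v) w) V :=
  (hG'.contDiffOn_ricAt.clm_apply (((hG.contDiffOn_chrDiff hG').clm_apply contDiffOn_const).clm_apply
    contDiffOn_const)).clm_apply contDiffOn_const

omit [Fintype ι] in
/-- `y ↦ Ric'_y(w, A_y(u,v))` is `C^∞` on `V`. [folklore] -/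
theorem IsMetricOn.contDiffOn_ric_chrDiff_right (hG : IsMetricOn G V) (hG' : IsMetricOn G' V) (u v w : E) :
    ContDiffOn ℝ ∞ (fun y ↦ ricAt G' y w (chrDiff G G' y u v)) V :=
  (hG'.contDiffOn_ricAt.clm_apply contDiffOn_const).clm_apply
    (((hG.contDiffOn_chrDiff hG').clm_apply contDiffOn_const).clm_apply contDiffOn_const)

omit [Fintype ι] in
/-- The brackets `uBracket` are `C^∞` on `V`. [folklore] -/
theorem IsMetricOn.contDiffOn_uBracket (hG : IsMetricOn G V) (hG' : IsMetricOn G' V) (Y Z : E) (j : ι) :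
    ContDiffOn ℝ ∞ (uBracket b G G' Y Z j) V := by
  have hl := hG.contDiffOn_ric_chrDiff_left hG'
  have hr := hG.contDiffOn_ric_chrDiff_right hG'
  exact (((((hl (b j) Y Z).neg.sub (hr (b j) Z Y)).add (hl Y Z (b j))).add (hl Z Y (b j))).add
    (hr Y (b j) Z)).add (hr Z (b j) Y)

omit [Fintype ι] in
/-- The brackets `vBracket` are `C^∞` on `V`. [folklore] -/
theorem IsMetricOn.contDiffOn_vBracket (hG : IsMetricOn G V) (hG' : IsMetricOn G' V) (Z : E) (i j : ι) :
    ContDiffOn ℝ ∞ (vBracket b G G' Z i j) V :=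
  ((hG.contDiffOn_ric_chrDiff_left hG' (b i) Z (b j)).neg).sub
    (hG.contDiffOn_ric_chrDiff_right hG' (b i) (b j) Z)

/-- **The potentials `Uⁱ` are `C^∞` on `V`.** [folklore] -/
theorem IsMetricOn.contDiffOn_uPot (hG : IsMetricOn G V) (hG' : IsMetricOn G' V) (Y Z : E) (i : ι) :
    ContDiffOn ℝ ∞ (uPot b G G' Y Z i) V :=
  ContDiffOn.sum fun j _ ↦ (hG'.contDiffOn_ginv b i j).mul (hG.contDiffOn_uBracket hG' Y Z j)

/-- **The potentials `V_Z` are `C^∞` on `V`.** [folklore] -/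
theorem IsMetricOn.contDiffOn_vPot (hG : IsMetricOn G V) (hG' : IsMetricOn G' V) (Z : E) :
    ContDiffOn ℝ ∞ (vPot b G G' Z) V :=
  ContDiffOn.sum fun i _ ↦ ContDiffOn.sum fun j _ ↦
    (hG'.contDiffOn_ginv b i j).mul (hG.contDiffOn_vBracket hG' Z i j)

end Smoothness

/-! ### Bounds on the potentials and on the correction -/

section Bounds

variable {b} {G G' : E → E →L[ℝ] E →L[ℝ] ℝ} {V : Set E} {x : E} {N : ℝ}

omit [Fintype ι] [CompleteSpace E] in
/-- `|uBracketⱼ(y)| ≤ 6 N² ‖A(y)‖ ‖Y‖‖Z‖`. [cite: Kotschwar2014, §1.1 (10)] -/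
theorem PairBound.abs_uBracket_le (hN : PairBound b G G' x N) (Y Z : E) (j : ι) :
    |uBracket b G G' Y Z j x| ≤ 6 * N ^ 2 * ‖chrDiff G G' x‖ * ‖Y‖ * ‖Z‖ := by
  have h0 := hN.nonneg
  have h1 := hN.one_le
  set A := chrDiff G G' x
  have hA : ∀ u v, ‖A u v‖ ≤ ‖A‖ * ‖u‖ * ‖v‖ := fun u v ↦ le_opNorm₂ A u v
  have hR : ∀ u v, ‖ricAt G' x u v‖ ≤ N * ‖u‖ * ‖v‖ := fun u v ↦
    (le_opNorm₂ _ u v).trans (by gcongr; exact hN.ric')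
  have hb := hN.basis j
  have t1 : ‖ricAt G' x (A (b j) Y) Z‖ ≤ N ^ 2 * ‖A‖ * ‖Y‖ * ‖Z‖ := by
    calc _ ≤ N * (‖A‖ * ‖b j‖ * ‖Y‖) * ‖Z‖ := (hR _ _).trans (by gcongr; exact hA _ _)
      _ ≤ N * (‖A‖ * N * ‖Y‖) * ‖Z‖ := by gcongr
      _ = _ := by ring
  have t2 : ‖ricAt G' x Y (A (b j) Z)‖ ≤ N ^ 2 * ‖A‖ * ‖Y‖ * ‖Z‖ := by
    calc _ ≤ N * ‖Y‖ * (‖A‖ * ‖b j‖ * ‖Z‖) := (hR _ _).trans (by gcongr; exact hA _ _)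
      _ ≤ N * ‖Y‖ * (‖A‖ * N * ‖Z‖) := by gcongr
      _ = _ := by ring
  have t3 : ‖ricAt G' x (A Y Z) (b j)‖ ≤ N ^ 2 * ‖A‖ * ‖Y‖ * ‖Z‖ := by
    calc _ ≤ N * (‖A‖ * ‖Y‖ * ‖Z‖) * ‖b j‖ := (hR _ _).trans (by gcongr; exact hA _ _)
      _ ≤ N * (‖A‖ * ‖Y‖ * ‖Z‖) * N := by gcongr
      _ = _ := by ring
  have t4 : ‖ricAt G' x (A Z Y) (b j)‖ ≤ N ^ 2 * ‖A‖ * ‖Y‖ * ‖Z‖ := by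
    calc _ ≤ N * (‖A‖ * ‖Z‖ * ‖Y‖) * ‖b j‖ := (hR _ _).trans (by gcongr; exact hA _ _)
      _ ≤ N * (‖A‖ * ‖Z‖ * ‖Y‖) * N := by gcongr
      _ = _ := by ring
  have t5 : ‖ricAt G' x Z (A Y (b j))‖ ≤ N ^ 2 * ‖A‖ * ‖Y‖ * ‖Z‖ := by
    calc _ ≤ N * ‖Z‖ * (‖A‖ * ‖Y‖ * ‖b j‖) := (hR _ _).trans (by gcongr; exact hA _ _)
      _ ≤ N * ‖Z‖ * (‖A‖ * ‖Y‖ * N) := by gcongr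
      _ = _ := by ring
  have t6 : ‖ricAt G' x Y (A Z (b j))‖ ≤ N ^ 2 * ‖A‖ * ‖Y‖ * ‖Z‖ := by
    calc _ ≤ N * ‖Y‖ * (‖A‖ * ‖Z‖ * ‖b j‖) := (hR _ _).trans (by gcongr; exact hA _ _)
      _ ≤ N * ‖Y‖ * (‖A‖ * ‖Z‖ * N) := by gcongr
      _ = _ := by ring
  rw [← Real.norm_eq_abs, uBracket]
  calc _ ≤ _ := norm_add_le_of_le (norm_add_le_of_le (norm_add_le_of_le (norm_add_le_of_le
      (norm_sub_le_of_le ((norm_neg _).trans_le t1) t2) t3) t4) t5) t6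
    _ = 6 * N ^ 2 * ‖A‖ * ‖Y‖ * ‖Z‖ := by ring

omit [CompleteSpace E] in
/-- **`|Uⁱ(y)| ≤ 6 n N⁵ ‖A(y)‖ ‖Y‖‖Z‖`** (Kotschwar's `|U| ≤ C(|h| + |A|)`; here no `h`-part since the
background connection is shared). [cite: Kotschwar2014, §1.1 (10)] -/
theorem PairBound.abs_uPot_le (hN : PairBound b G G' x N) (Y Z : E) (i : ι) :
    |uPot b G G' Y Z i x| ≤ 6 * (Fintype.card ι : ℝ) * N ^ 5 * ‖chrDiff G G' x‖ * ‖Y‖ * ‖Z‖ := by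
  have h0 := hN.nonneg
  have h1 := hN.one_le
  have key : ∀ j, |ginv G' b x i j * uBracket b G G' Y Z j x| ≤ N ^ 5 * (6 * ‖chrDiff G G' x‖ * ‖Y‖ * ‖Z‖) := by
    intro j
    rw [abs_mul]
    calc _ ≤ N ^ 3 * (6 * N ^ 2 * ‖chrDiff G G' x‖ * ‖Y‖ * ‖Z‖) :=
          mul_le_mul (hN.abs_ginv'_le i j) (hN.abs_uBracket_le Y Z j) (abs_nonneg _) (by positivity)
      _ = _ := by ring
  calc |uPot b G G' Y Z i x| ≤ ∑ j, |ginv G' b x i j * uBracket b G G' Y Z j x| := Finset.abs_sum_le_sum_abs _ _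
    _ ≤ ∑ j : ι, N ^ 5 * (6 * ‖chrDiff G G' x‖ * ‖Y‖ * ‖Z‖) := Finset.sum_le_sum fun j _ ↦ key j
    _ = _ := by simp only [Finset.sum_const, Finset.card_univ, nsmul_eq_mul]; ring

omit [Fintype ι] [CompleteSpace E] in
/-- `|vBracket_Z(i,j)(y)| ≤ 2 N³ ‖A(y)‖ ‖Z‖`. [cite: Kotschwar2014, §1.1 (10)] -/
theorem PairBound.abs_vBracket_le (hN : PairBound b G G' x N) (Z : E) (i j : ι) :
    |vBracket b G G' Z i j x| ≤ 2 * N ^ 3 * ‖chrDiff G G' x‖ * ‖Z‖ := by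
  have h0 := hN.nonneg
  have h1 := hN.one_le
  set A := chrDiff G G' x
  have hA : ∀ u v, ‖A u v‖ ≤ ‖A‖ * ‖u‖ * ‖v‖ := fun u v ↦ le_opNorm₂ A u v
  have hR : ∀ u v, ‖ricAt G' x u v‖ ≤ N * ‖u‖ * ‖v‖ := fun u v ↦
    (le_opNorm₂ _ u v).trans (by gcongr; exact hN.ric')
  have hbi := hN.basis i
  have hbj := hN.basis j
  have t1 : ‖ricAt G' x (A (b i) Z) (b j)‖ ≤ N ^ 3 * ‖A‖ * ‖Z‖ := by
    calc _ ≤ N * (‖A‖ * ‖b i‖ * ‖Z‖) * ‖b j‖ := (hR _ _).trans (by gcongr; exact hA _ _)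
      _ ≤ N * (‖A‖ * N * ‖Z‖) * N := by gcongr
      _ = _ := by ring
  have t2 : ‖ricAt G' x Z (A (b i) (b j))‖ ≤ N ^ 3 * ‖A‖ * ‖Z‖ := by
    calc _ ≤ N * ‖Z‖ * (‖A‖ * ‖b i‖ * ‖b j‖) := (hR _ _).trans (by gcongr; exact hA _ _)
      _ ≤ N * ‖Z‖ * (‖A‖ * N * N) := by gcongr
      _ = _ := by ring
  rw [← Real.norm_eq_abs, vBracket]
  calc _ ≤ _ := norm_sub_le_of_le ((norm_neg _).trans_le t1) t2
    _ = 2 * N ^ 3 * ‖A‖ * ‖Z‖ := by ring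

omit [CompleteSpace E] in
/-- **`|V_Z(y)| ≤ 2 n² N⁶ ‖A(y)‖ ‖Z‖`.** [cite: Kotschwar2014, §1.1 (10)] -/
theorem PairBound.abs_vPot_le (hN : PairBound b G G' x N) (Z : E) :
    |vPot b G G' Z x| ≤ 2 * (Fintype.card ι : ℝ) ^ 2 * N ^ 6 * ‖chrDiff G G' x‖ * ‖Z‖ := by
  have h0 := hN.nonneg
  have h1 := hN.one_le
  have key : ∀ i j, |ginv G' b x i j * vBracket b G G' Z i j x| ≤ N ^ 6 * (2 * ‖chrDiff G G' x‖ * ‖Z‖) := by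
    intro i j
    rw [abs_mul]
    calc _ ≤ N ^ 3 * (2 * N ^ 3 * ‖chrDiff G G' x‖ * ‖Z‖) :=
          mul_le_mul (hN.abs_ginv'_le i j) (hN.abs_vBracket_le Z i j) (abs_nonneg _) (by positivity)
      _ = _ := by ring
  calc |vPot b G G' Z x| ≤ ∑ i, |∑ j, ginv G' b x i j * vBracket b G G' Z i j x| := Finset.abs_sum_le_sum_abs _ _
    _ ≤ ∑ i, ∑ j, |ginv G' b x i j * vBracket b G G' Z i j x| :=
        Finset.sum_le_sum fun i _ ↦ Finset.abs_sum_le_sum_abs _ _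
    _ ≤ ∑ i : ι, ∑ j : ι, N ^ 6 * (2 * ‖chrDiff G G' x‖ * ‖Z‖) :=
        Finset.sum_le_sum fun i _ ↦ Finset.sum_le_sum fun j _ ↦ key i j
    _ = _ := by simp only [Finset.sum_const, Finset.card_univ, nsmul_eq_mul]; ring

omit [Fintype ι] [FiniteDimensional ℝ E] in
/-- `‖D♯'(W)‖ ≤ ‖♯'‖² ‖DG'‖ ‖W‖` (`∂_W ♯ = −♯ ∂_W G ♯`). [folklore] -/
theorem IsMetricOn.norm_fderiv_sharpAt_apply_le (hG' : IsMetricOn G' V) (hx : x ∈ V) (W : E) :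
    ‖fderiv ℝ (sharpAt G') x W‖ ≤ ‖sharpAt G' x‖ * ‖fderiv ℝ G' x‖ * ‖sharpAt G' x‖ * ‖W‖ := by
  rw [hG'.fderiv_sharpAt hx W, norm_neg]
  calc _ ≤ ‖sharpAt G' x‖ * ‖(fderiv ℝ G' x W).comp (sharpAt G' x)‖ := opNorm_comp_le _ _
    _ ≤ ‖sharpAt G' x‖ * (‖fderiv ℝ G' x W‖ * ‖sharpAt G' x‖) := by gcongr; exact opNorm_comp_le _ _
    _ ≤ ‖sharpAt G' x‖ * ((‖fderiv ℝ G' x‖ * ‖W‖) * ‖sharpAt G' x‖) := by gcongr; exact le_opNorm _ _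
    _ = _ := by ring

omit [Fintype ι] in
/-- `|∂_W g'^{ij}| ≤ N⁵ ‖W‖`. [folklore] -/
theorem PairBound.abs_dginv_le (hN : PairBound b G G' x N) (hG' : IsMetricOn G' V) (hx : x ∈ V)
    (W : E) (i j : ι) : |dginv b G' x W i j| ≤ N ^ 5 * ‖W‖ := by
  have h0 := hN.nonneg
  have h1 := hN.one_le
  rw [dginv, ← Real.norm_eq_abs]
  calc ‖coordCLM b i (fderiv ℝ (sharpAt G') x W (coordCLM b j))‖
      ≤ ‖coordCLM b i‖ * (‖fderiv ℝ (sharpAt G') x W‖ * ‖coordCLM b j‖) :=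
        (le_opNorm _ _).trans (by gcongr; exact le_opNorm _ _)
    _ ≤ N * ((‖sharpAt G' x‖ * ‖fderiv ℝ G' x‖ * ‖sharpAt G' x‖ * ‖W‖) * N) := by
        gcongr
        exacts [hN.coord i, hG'.norm_fderiv_sharpAt_apply_le hx W, hN.coord j]
    _ ≤ N * ((N * N * N * ‖W‖) * N) := by gcongr; exacts [hN.sharp', hN.dmetric', hN.sharp']
    _ = N ^ 5 * ‖W‖ := by ring

omit [Fintype ι] [CompleteSpace E] in
/-- `|duA_j(x)(W)| ≤ 6 N³ ‖A‖ ‖W‖‖Y‖‖Z‖`. [cite: Kotschwar2014, §1.1 (10)] -/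
theorem PairBound.abs_duA_le (hN : PairBound b G G' x N) (Y Z : E) (j : ι) (W : E) :
    |duA b G G' Y Z j x W| ≤ 6 * N ^ 3 * ‖chrDiff G G' x‖ * ‖W‖ * ‖Y‖ * ‖Z‖ := by
  have h0 := hN.nonneg
  have h1 := hN.one_le
  set A := chrDiff G G' x
  set D := fderiv ℝ (ricAt G') x
  have hA : ∀ u v, ‖A u v‖ ≤ ‖A‖ * ‖u‖ * ‖v‖ := fun u v ↦ le_opNorm₂ A u v
  have hD : ∀ u v w, ‖D u v w‖ ≤ N * ‖u‖ * ‖v‖ * ‖w‖ := fun u v w ↦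
    (norm_map₃_le D u v w).trans (by gcongr; exact hN.dric')
  have hb := hN.basis j
  have t1 : ‖D W (A (b j) Y) Z‖ ≤ N ^ 3 * ‖A‖ * ‖W‖ * ‖Y‖ * ‖Z‖ := by
    calc _ ≤ N * ‖W‖ * (‖A‖ * ‖b j‖ * ‖Y‖) * ‖Z‖ := (hD _ _ _).trans (by gcongr; exact hA _ _)
      _ ≤ N * ‖W‖ * (‖A‖ * N * ‖Y‖) * ‖Z‖ := by gcongr
      _ = N ^ 2 * ‖A‖ * ‖W‖ * ‖Y‖ * ‖Z‖ := by ring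
      _ ≤ _ := by gcongr; first | exact h1 | norm_num
  have t2 : ‖D W Y (A (b j) Z)‖ ≤ N ^ 3 * ‖A‖ * ‖W‖ * ‖Y‖ * ‖Z‖ := by
    calc _ ≤ N * ‖W‖ * ‖Y‖ * (‖A‖ * ‖b j‖ * ‖Z‖) := (hD _ _ _).trans (by gcongr; exact hA _ _)
      _ ≤ N * ‖W‖ * ‖Y‖ * (‖A‖ * N * ‖Z‖) := by gcongr
      _ = N ^ 2 * ‖A‖ * ‖W‖ * ‖Y‖ * ‖Z‖ := by ring
      _ ≤ _ := by gcongr; first | exact h1 | norm_num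
  have t3 : ‖D W (A Y Z) (b j)‖ ≤ N ^ 3 * ‖A‖ * ‖W‖ * ‖Y‖ * ‖Z‖ := by
    calc _ ≤ N * ‖W‖ * (‖A‖ * ‖Y‖ * ‖Z‖) * ‖b j‖ := (hD _ _ _).trans (by gcongr; exact hA _ _)
      _ ≤ N * ‖W‖ * (‖A‖ * ‖Y‖ * ‖Z‖) * N := by gcongr
      _ = N ^ 2 * ‖A‖ * ‖W‖ * ‖Y‖ * ‖Z‖ := by ring
      _ ≤ _ := by gcongr; first | exact h1 | norm_num
  have t4 : ‖D W (A Z Y) (b j)‖ ≤ N ^ 3 * ‖A‖ * ‖W‖ * ‖Y‖ * ‖Z‖ := by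
    calc _ ≤ N * ‖W‖ * (‖A‖ * ‖Z‖ * ‖Y‖) * ‖b j‖ := (hD _ _ _).trans (by gcongr; exact hA _ _)
      _ ≤ N * ‖W‖ * (‖A‖ * ‖Z‖ * ‖Y‖) * N := by gcongr
      _ = N ^ 2 * ‖A‖ * ‖W‖ * ‖Y‖ * ‖Z‖ := by ring
      _ ≤ _ := by gcongr; first | exact h1 | norm_num
  have t5 : ‖D W Z (A Y (b j))‖ ≤ N ^ 3 * ‖A‖ * ‖W‖ * ‖Y‖ * ‖Z‖ := by
    calc _ ≤ N * ‖W‖ * ‖Z‖ * (‖A‖ * ‖Y‖ * ‖b j‖) := (hD _ _ _).trans (by gcongr; exact hA _ _)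
      _ ≤ N * ‖W‖ * ‖Z‖ * (‖A‖ * ‖Y‖ * N) := by gcongr
      _ = N ^ 2 * ‖A‖ * ‖W‖ * ‖Y‖ * ‖Z‖ := by ring
      _ ≤ _ := by gcongr; first | exact h1 | norm_num
  have t6 : ‖D W Y (A Z (b j))‖ ≤ N ^ 3 * ‖A‖ * ‖W‖ * ‖Y‖ * ‖Z‖ := by
    calc _ ≤ N * ‖W‖ * ‖Y‖ * (‖A‖ * ‖Z‖ * ‖b j‖) := (hD _ _ _).trans (by gcongr; exact hA _ _)
      _ ≤ N * ‖W‖ * ‖Y‖ * (‖A‖ * ‖Z‖ * N) := by gcongr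
      _ = N ^ 2 * ‖A‖ * ‖W‖ * ‖Y‖ * ‖Z‖ := by ring
      _ ≤ _ := by gcongr; first | exact h1 | norm_num
  rw [← Real.norm_eq_abs, duA]
  calc _ ≤ _ := norm_add_le_of_le (norm_add_le_of_le (norm_add_le_of_le (norm_add_le_of_le
      (norm_sub_le_of_le ((norm_neg _).trans_le t1) t2) t3) t4) t5) t6
    _ = 6 * N ^ 3 * ‖A‖ * ‖W‖ * ‖Y‖ * ‖Z‖ := by ring

omit [Fintype ι] [CompleteSpace E] in
/-- `|dvA_Z(i,j)(x)(W)| ≤ 2 N⁴ ‖A‖ ‖W‖‖Z‖`. [cite: Kotschwar2014, §1.1 (10)] -/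
theorem PairBound.abs_dvA_le (hN : PairBound b G G' x N) (Z : E) (i j : ι) (W : E) :
    |dvA b G G' Z i j x W| ≤ 2 * N ^ 4 * ‖chrDiff G G' x‖ * ‖W‖ * ‖Z‖ := by
  have h0 := hN.nonneg
  have h1 := hN.one_le
  set A := chrDiff G G' x
  set D := fderiv ℝ (ricAt G') x
  have hA : ∀ u v, ‖A u v‖ ≤ ‖A‖ * ‖u‖ * ‖v‖ := fun u v ↦ le_opNorm₂ A u v
  have hD : ∀ u v w, ‖D u v w‖ ≤ N * ‖u‖ * ‖v‖ * ‖w‖ := fun u v w ↦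
    (norm_map₃_le D u v w).trans (by gcongr; exact hN.dric')
  have hbi := hN.basis i
  have hbj := hN.basis j
  have t1 : ‖D W (A (b i) Z) (b j)‖ ≤ N ^ 3 * ‖A‖ * ‖W‖ * ‖Z‖ := by
    calc _ ≤ N * ‖W‖ * (‖A‖ * ‖b i‖ * ‖Z‖) * ‖b j‖ := (hD _ _ _).trans (by gcongr; exact hA _ _)
      _ ≤ N * ‖W‖ * (‖A‖ * N * ‖Z‖) * N := by gcongr
      _ = _ := by ring
  have t2 : ‖D W Z (A (b i) (b j))‖ ≤ N ^ 3 * ‖A‖ * ‖W‖ * ‖Z‖ := by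
    calc _ ≤ N * ‖W‖ * ‖Z‖ * (‖A‖ * ‖b i‖ * ‖b j‖) := (hD _ _ _).trans (by gcongr; exact hA _ _)
      _ ≤ N * ‖W‖ * ‖Z‖ * (‖A‖ * N * N) := by gcongr
      _ = _ := by ring
  rw [← Real.norm_eq_abs, dvA]
  calc _ ≤ _ := norm_sub_le_of_le ((norm_neg _).trans_le t1) t2
    _ = 2 * N ^ 3 * ‖A‖ * ‖W‖ * ‖Z‖ := by ring
    _ ≤ 2 * N ^ 4 * ‖A‖ * ‖W‖ * ‖Z‖ := by gcongr; first | exact h1 | norm_num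

/-- **The bound on the correction**: `|divCorr| ≤ 20 n² N⁸ ‖A‖ ‖Y‖‖Z‖`.
[cite: Kotschwar2014, §1.1 (10)] -/
theorem PairBound.abs_divCorr_le (hN : PairBound b G G' x N) (hG' : IsMetricOn G' V) (hx : x ∈ V) (Y Z : E) :
    |divCorr b G G' x Y Z| ≤ 20 * (Fintype.card ι : ℝ) ^ 2 * N ^ 8 * ‖chrDiff G G' x‖ * ‖Y‖ * ‖Z‖ := by
  have h0 := hN.nonneg
  have h1 := hN.one_le
  set A := ‖chrDiff G G' x‖ with hA
  have hA0 : 0 ≤ A := norm_nonneg _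
  have key : ∀ i j, |dginv b G' x (b i) i j * uBracket b G G' Y Z j x + ginv G' b x i j * duA b G G' Y Z j x (b i)
      + dginv b G' x Y i j * vBracket b G G' Z i j x + ginv G' b x i j * dvA b G G' Z i j x Y
      + dginv b G' x Z i j * vBracket b G G' Y i j x + ginv G' b x i j * dvA b G G' Y i j x Z|
      ≤ 20 * N ^ 8 * A * ‖Y‖ * ‖Z‖ := by
    intro i j
    have hbi := hN.basis i
    have p1 : |dginv b G' x (b i) i j * uBracket b G G' Y Z j x| ≤ 6 * N ^ 8 * A * ‖Y‖ * ‖Z‖ := by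
      rw [abs_mul]
      calc _ ≤ (N ^ 5 * ‖b i‖) * (6 * N ^ 2 * A * ‖Y‖ * ‖Z‖) :=
            mul_le_mul (hN.abs_dginv_le hG' hx (b i) i j) (hN.abs_uBracket_le Y Z j) (abs_nonneg _) (by positivity)
        _ ≤ (N ^ 5 * N) * (6 * N ^ 2 * A * ‖Y‖ * ‖Z‖) := by gcongr
        _ = 6 * N ^ 8 * A * ‖Y‖ * ‖Z‖ := by ring
    have p2 : |ginv G' b x i j * duA b G G' Y Z j x (b i)| ≤ 6 * N ^ 8 * A * ‖Y‖ * ‖Z‖ := by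
      rw [abs_mul]
      calc _ ≤ N ^ 3 * (6 * N ^ 3 * A * ‖b i‖ * ‖Y‖ * ‖Z‖) :=
            mul_le_mul (hN.abs_ginv'_le i j) (hN.abs_duA_le Y Z j (b i)) (abs_nonneg _) (by positivity)
        _ ≤ N ^ 3 * (6 * N ^ 3 * A * N * ‖Y‖ * ‖Z‖) := by gcongr
        _ = 6 * N ^ 7 * A * ‖Y‖ * ‖Z‖ := by ring
        _ ≤ 6 * N ^ 8 * A * ‖Y‖ * ‖Z‖ := by gcongr; first | exact h1 | norm_num
    have p3 : |dginv b G' x Y i j * vBracket b G G' Z i j x| ≤ 2 * N ^ 8 * A * ‖Y‖ * ‖Z‖ := by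
      rw [abs_mul]
      calc _ ≤ (N ^ 5 * ‖Y‖) * (2 * N ^ 3 * A * ‖Z‖) :=
            mul_le_mul (hN.abs_dginv_le hG' hx Y i j) (hN.abs_vBracket_le Z i j) (abs_nonneg _) (by positivity)
        _ = 2 * N ^ 8 * A * ‖Y‖ * ‖Z‖ := by ring
    have p4 : |ginv G' b x i j * dvA b G G' Z i j x Y| ≤ 2 * N ^ 8 * A * ‖Y‖ * ‖Z‖ := by
      rw [abs_mul]
      calc _ ≤ N ^ 3 * (2 * N ^ 4 * A * ‖Y‖ * ‖Z‖) :=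
            mul_le_mul (hN.abs_ginv'_le i j) (hN.abs_dvA_le Z i j Y) (abs_nonneg _) (by positivity)
        _ = 2 * N ^ 7 * A * ‖Y‖ * ‖Z‖ := by ring
        _ ≤ 2 * N ^ 8 * A * ‖Y‖ * ‖Z‖ := by gcongr; first | exact h1 | norm_num
    have p5 : |dginv b G' x Z i j * vBracket b G G' Y i j x| ≤ 2 * N ^ 8 * A * ‖Y‖ * ‖Z‖ := by
      rw [abs_mul]
      calc _ ≤ (N ^ 5 * ‖Z‖) * (2 * N ^ 3 * A * ‖Y‖) :=
            mul_le_mul (hN.abs_dginv_le hG' hx Z i j) (hN.abs_vBracket_le Y i j) (abs_nonneg _) (by positivity)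
        _ = 2 * N ^ 8 * A * ‖Y‖ * ‖Z‖ := by ring
    have p6 : |ginv G' b x i j * dvA b G G' Y i j x Z| ≤ 2 * N ^ 8 * A * ‖Y‖ * ‖Z‖ := by
      rw [abs_mul]
      calc _ ≤ N ^ 3 * (2 * N ^ 4 * A * ‖Z‖ * ‖Y‖) :=
            mul_le_mul (hN.abs_ginv'_le i j) (hN.abs_dvA_le Y i j Z) (abs_nonneg _) (by positivity)
        _ = 2 * N ^ 7 * A * ‖Y‖ * ‖Z‖ := by ring
        _ ≤ 2 * N ^ 8 * A * ‖Y‖ * ‖Z‖ := by gcongr; first | exact h1 | norm_num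
    have s2 := (abs_add_le _ _).trans (add_le_add p1 p2)
    have s3 := (abs_add_le _ _).trans (add_le_add s2 p3)
    have s4 := (abs_add_le _ _).trans (add_le_add s3 p4)
    have s5 := (abs_add_le _ _).trans (add_le_add s4 p5)
    have s6 := (abs_add_le _ _).trans (add_le_add s5 p6)
    linarith
  calc |divCorr b G G' x Y Z|
      ≤ ∑ i, |∑ j, (dginv b G' x (b i) i j * uBracket b G G' Y Z j x + ginv G' b x i j * duA b G G' Y Z j x (b i)
        + dginv b G' x Y i j * vBracket b G G' Z i j x + ginv G' b x i j * dvA b G G' Z i j x Y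
        + dginv b G' x Z i j * vBracket b G G' Y i j x + ginv G' b x i j * dvA b G G' Y i j x Z)| :=
        Finset.abs_sum_le_sum_abs _ _
    _ ≤ ∑ i, ∑ j, |dginv b G' x (b i) i j * uBracket b G G' Y Z j x + ginv G' b x i j * duA b G G' Y Z j x (b i)
        + dginv b G' x Y i j * vBracket b G G' Z i j x + ginv G' b x i j * dvA b G G' Z i j x Y
        + dginv b G' x Z i j * vBracket b G G' Y i j x + ginv G' b x i j * dvA b G G' Y i j x Z| :=
        Finset.sum_le_sum fun i _ ↦ Finset.abs_sum_le_sum_abs _ _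
    _ ≤ ∑ i : ι, ∑ j : ι, 20 * N ^ 8 * A * ‖Y‖ * ‖Z‖ := Finset.sum_le_sum fun i _ ↦ Finset.sum_le_sum fun j _ ↦ key i j
    _ = _ := by simp only [Finset.sum_const, Finset.card_univ, nsmul_eq_mul]; ring

end Bounds


end MetricCoord

end Literature.Geometry.Lorentzian

end
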